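import Literature.NumberTheory.Automorphic.UnramifiedOrbitSetAdelic
import Literature.NumberTheory.Automorphic.CompactCoreLevelPoint
import Literature.NumberTheory.Rogawski1990.TestFunctionsPair
import HarnessLib

/-!
# The orbit set, the unit factors `Φ_v([(γ_H)_v], 1_{K_{H,v}}) = 1` and the canonical normalisation on a PRODUCT
# `H = U(H₂) × U(H₁)` — the endoscopic side `H = U(2) × U(1)` (Kottwitz (1986), Prop. 7.1, Cor. 7.3; Rogawski (1990), §4.3 pp. 43–44, §4.9 p. 54)

Topic `NumberTheory/Automorphic`; namespaces `Literature.MeasureTheory.Group` (§1, generic group theory), `Literature.NumberTheory.Automorphic`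
(§1, compact cores) and `Literature.NumberTheory.Automorphic.UnitaryGroup` (§§2–4); THEOREMS ONLY (no definition, no instance, no named fact, no
`sorry`).  ★ `UnramifiedOrbitalUnitFactor` ∕ ★ `UnramifiedOrbitSetHermitian` ∕ ★ `CompactCoreLevelPoint` deliver, for ONE unitary group `U(H)` with
`H` hermitian and `det H ≠ 0` and a rational regular `γ`, at almost every finite place `v`: Kottwitz's orbit lemma
`{y ∣ y γ_v y⁻¹ ∈ K_v} ⊆ K_v · Z(γ_v)` (★ `unramifiedOrbitSetAE_of_hermitian`), `compactCore Z(γ_v) ⊆ K_v` (★ `compactCoreCentralizerLevelAE_of_hermitian`),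
whence `Φ_v([γ_v], 1_{K_v}) = m_v(π K_v)` and the canonical normalisation `m_v(π K_v) = 1`.  The endoscopic group of [Rogawski1990] §4 is a
PRODUCT `H = U(Φ₂) × U(Φ₁)` whose local orbital measure families `m^H_v` live on the product local group
`U(H₂)(L⁺_v) × U(H₁)(L⁺_v)` (the carrier of ★ `Rogawski1990.IsLocalDeltaTransfer`, ★ `PureTensor₂.loc`) and need not be product measures; this file
transports the three statements to such products:

* §1 **`orbitSet_prod`** — orbit sets multiply (★ `centralizer_singleton_prod_eq`): the two factor inclusions give
  `{y ∈ G₁ × G₂ ∣ y (a, b) y⁻¹ ∈ K₁ × K₂} ⊆ (K₁ × K₂) · Z((a, b))`; **`compactCore_centralizer_prodMk_subset`** — the compact core of `Z((a, b))`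
  projects into the compact cores of `Z(a)`, `Z(b)` (continuous images of compact subgroups); `isRegularElt_fin_one` — regularity in `GL₁` is automatic.
* §2 **`eventually_forall_orbitSet_pair`** — for `H₂`, `H₁` hermitian non-degenerate and rational regular `γ₂`, `γ₁`: for almost every `v`, the orbit
  set of `((γ₂)_v, (γ₁)_v)` for `K_{H,v} = U(H₂)(𝒪_v) × U(H₁)(𝒪_v)` lies in `K_{H,v} · Z(((γ₂)_v, (γ₁)_v))`; `eventually_compactCore_centralizer_pair_subset`.
* §3 **`eventually_classOrbitalIntegral_indicator_eq_one_pair`** — for local CLASS-indexed families `mH v` on the product, invariant at the class and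
  normalised at the pair off `S₀` (`(mH v).atPoint (γ_H)_v (π K_{H,v}) = 1`, the literal of ★ `IsNormalisedOff` on the product):
  `Φ_v([(γ_H)_v], 1_{K_{H,v}}) = 1` a.e.; **`exists_finset_forall_classOrbitalIntegral_loc_eq_one_pair`** — the `h1` shape for an unramified
  ★ `PureTensor₂` (`T.IsUnramified₂`): `∃ S₂ ⊇ T.S, ∀ v ∉ S₂, Φ_v([(γ_H)_v], T.loc v) = 1`.
* §4 **`exists_finset_forall_atPoint_pair_eq_one_of_isCanonical`** — canonical families (★ `IsCanonical`) for Haar measures `νH v` with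
  `νH v (K_{H,v}) = 1` ARE normalised at the pair off a finite set (★ `IsCanonical.atPoint_image_mk_eq_one`).
The endoscopic literals `H = U(Φ₂) × U(Φ₁)` at a rational `γ_H` (★ `Rogawski1990.rationalComponent`) are read off in
`Rogawski1990/UnramifiedOrbitalUnitFactorEndoscopic`.

## References
* R. E. Kottwitz, *Stable trace formula: elliptic singular terms*, Math. Ann. 275 (1986), §7, Prop. 7.1, Cor. 7.3 [Kottwitz1986].
* J. D. Rogawski, *Automorphic Representations of Unitary Groups in Three Variables*, Ann. of Math. Stud. 123 (1990), §4.3 pp. 43–44, §4.9 p. 54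
  [Rogawski1990].
* N. Bourbaki, *General Topology*, Ch. III §2 (compact subgroups) [BourbakiGT1].
-/

set_option autoImplicit false

noncomputable section

open MeasureTheory NumberField IsDedekindDomain Filter Polynomial
open Literature.MeasureTheory.Group Literature.NumberTheory.Rogawski1990
open scoped Matrix Pointwise

/-! ## §1 Generic: orbit sets, centralisers and compact cores on a product of two groups -/

namespace Literature.MeasureTheory.Group

section Prod

variable {G₁ G₂ : Type*} [Group G₁] [Group G₂]

/-- `y₁ ∈ K₁ · Z(a)` and `y₂ ∈ K₂ · Z(b)` give `(y₁, y₂) ∈ (K₁ × K₂) · Z((a, b))`. [cite: Kottwitz1986, Prop. 7.1] -/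
theorem mem_coe_prod_mul_centralizer (K₁ : Subgroup G₁) (K₂ : Subgroup G₂) (a : G₁) (b : G₂) {y : G₁ × G₂}
    (h₁ : y.1 ∈ (K₁ : Set G₁) * (Subgroup.centralizer ({a} : Set G₁) : Set G₁))
    (h₂ : y.2 ∈ (K₂ : Set G₂) * (Subgroup.centralizer ({b} : Set G₂) : Set G₂)) :
    y ∈ ((K₁.prod K₂ : Subgroup (G₁ × G₂)) : Set (G₁ × G₂)) *
      (Subgroup.centralizer ({(a, b)} : Set (G₁ × G₂)) : Set (G₁ × G₂)) := by
  obtain ⟨k₁, hk₁, z₁, hz₁, hy₁⟩ := Set.mem_mul.1 h₁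
  obtain ⟨k₂, hk₂, z₂, hz₂, hy₂⟩ := Set.mem_mul.1 h₂
  refine Set.mem_mul.2 ⟨(k₁, k₂), ⟨hk₁, hk₂⟩, (z₁, z₂), ?_, Prod.ext hy₁ hy₂⟩
  rw [SetLike.mem_coe, centralizer_singleton_prod_eq]
  exact ⟨hz₁, hz₂⟩

/-- **Orbit sets multiply** (Kottwitz's orbit lemma on a product): if `{y₁ ∣ y₁ a y₁⁻¹ ∈ K₁} ⊆ K₁ · Z(a)` and `{y₂ ∣ y₂ b y₂⁻¹ ∈ K₂} ⊆ K₂ · Z(b)`,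
then `{y ∣ y (a, b) y⁻¹ ∈ K₁ × K₂} ⊆ (K₁ × K₂) · Z((a, b))`. [cite: Kottwitz1986, Prop. 7.1] -/
theorem orbitSet_prod (K₁ : Subgroup G₁) (K₂ : Subgroup G₂) (a : G₁) (b : G₂)
    (h₁ : ∀ y : G₁, y * a * y⁻¹ ∈ K₁ → y ∈ (K₁ : Set G₁) * (Subgroup.centralizer ({a} : Set G₁) : Set G₁))
    (h₂ : ∀ y : G₂, y * b * y⁻¹ ∈ K₂ → y ∈ (K₂ : Set G₂) * (Subgroup.centralizer ({b} : Set G₂) : Set G₂)) :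
    ∀ y : G₁ × G₂, y * (a, b) * y⁻¹ ∈ K₁.prod K₂ →
      y ∈ ((K₁.prod K₂ : Subgroup (G₁ × G₂)) : Set (G₁ × G₂)) *
        (Subgroup.centralizer ({(a, b)} : Set (G₁ × G₂)) : Set (G₁ × G₂)) := by
  intro y hy
  rw [Subgroup.mem_prod, Prod.fst_mul, Prod.snd_mul, Prod.fst_mul, Prod.snd_mul, Prod.fst_inv, Prod.snd_inv] at hy
  exact mem_coe_prod_mul_centralizer K₁ K₂ a b (h₁ y.1 hy.1) (h₂ y.2 hy.2)

end Prod

end Literature.MeasureTheory.Group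

namespace Literature.NumberTheory.Automorphic

section CompactCoreProd

variable {G G' G₁ G₂ : Type*} [Group G] [Group G'] [Group G₁] [Group G₂]
  [TopologicalSpace G] [TopologicalSpace G'] [TopologicalSpace G₁] [TopologicalSpace G₂]

/-- **Compact cores of centralisers are functorial** for a continuous homomorphism `φ`: an element of a compact subgroup of `Z(g)` maps into a
compact subgroup of `Z(φ g)`; so `compactCore Z(φ g) ⊆ A` forces `φ x ∈ A` for `x ∈ compactCore Z(g)`. [cite: BourbakiGT1, Ch. III §2] -/
theorem apply_coe_mem_of_mem_compactCore (φ : G →* G') (hφ : Continuous φ) (g : G) (g' : G') (hg' : φ g = g') {A : Set G'}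
    (hA : compactCore (Subgroup.centralizer ({g'} : Set G')) ⊆ Subtype.val ⁻¹' A)
    {x : Subgroup.centralizer ({g} : Set G)} (hx : x ∈ compactCore (Subgroup.centralizer ({g} : Set G))) :
    φ (x : G) ∈ A := by
  obtain ⟨K₀, hK₀, hxK₀⟩ := (mem_compactCore_iff x).1 hx
  have hmem : ∀ z : Subgroup.centralizer ({g} : Set G), φ (z : G) ∈ Subgroup.centralizer ({g'} : Set G') := fun z => by
    rw [Subgroup.mem_centralizer_singleton_iff, ← hg', ← map_mul, ← map_mul, Subgroup.mem_centralizer_singleton_iff.1 z.2]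
  let ψ : Subgroup.centralizer ({g} : Set G) →* Subgroup.centralizer ({g'} : Set G') :=
    (φ.comp (Subgroup.centralizer ({g} : Set G)).subtype).codRestrict _ hmem
  have hψc : Continuous ψ := (hφ.comp continuous_subtype_val).subtype_mk _
  have hψx : ψ x ∈ compactCore (Subgroup.centralizer ({g'} : Set G')) :=
    (mem_compactCore_iff _).2 ⟨K₀.map ψ, by simpa [Subgroup.coe_map] using hK₀.image hψc, ⟨x, hxK₀, rfl⟩⟩
  exact hA hψx

/-- **The compact core of `Z((a, b))` projects into the compact cores of `Z(a)` and `Z(b)`**: `compactCore Z(a) ⊆ A` and `compactCore Z(b) ⊆ B`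
give `compactCore Z((a, b)) ⊆ A × B`. [cite: BourbakiGT1, Ch. III §2] -/
theorem compactCore_centralizer_prodMk_subset (a : G₁) (b : G₂) {A : Set G₁} {B : Set G₂}
    (hA : compactCore (Subgroup.centralizer ({a} : Set G₁)) ⊆ Subtype.val ⁻¹' A)
    (hB : compactCore (Subgroup.centralizer ({b} : Set G₂)) ⊆ Subtype.val ⁻¹' B) :
    compactCore (Subgroup.centralizer ({(a, b)} : Set (G₁ × G₂))) ⊆ Subtype.val ⁻¹' (A ×ˢ B) := fun _ hx =>
  ⟨apply_coe_mem_of_mem_compactCore (MonoidHom.fst G₁ G₂) continuous_fst (a, b) a rfl hA hx,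
    apply_coe_mem_of_mem_compactCore (MonoidHom.snd G₁ G₂) continuous_snd (a, b) b rfl hB hx⟩

end CompactCoreProd

end Literature.NumberTheory.Automorphic

namespace Literature.NumberTheory.Rogawski1990

/-- **Every element of `GL₁` is regular**: its characteristic polynomial `X - a` is separable. [cite: Rogawski1990, §3.1 p. 19] -/
theorem isRegularElt_fin_one {R : Type*} [CommRing R] [Nontrivial R] (g : GL (Fin 1) R) : IsRegularElt g := by
  rw [isRegularElt_iff]
  have hd : ((g : Matrix (Fin 1) (Fin 1) R).charpoly).natDegree = 1 := by
    rw [Matrix.charpoly_natDegree_eq_dim, Fintype.card_fin]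
  rw [(Matrix.charpoly_monic (g : Matrix (Fin 1) (Fin 1) R)).eq_X_add_C hd]
  exact Polynomial.separable_X_add_C _

end Literature.NumberTheory.Rogawski1990

/-! ## §2 The pair `H = U(H₂) × U(H₁)`: orbit set and compact core at almost every place -/

namespace Literature.NumberTheory.Automorphic.UnitaryGroup

variable (L : Type) [Field L] [NumberField L] [IsCMField L] {N₂ N₁ : ℕ}
  (H₂ : Matrix (Fin N₂) (Fin N₂) L) (H₁ : Matrix (Fin N₁) (Fin N₁) L)

/-- The pair `((γ₂)_v, (γ₁)_v)` lies in `K_{H,v} = U(H₂)(𝒪_v) × U(H₁)(𝒪_v)` for almost every `v` (★ `eventually_toLocal_mem_cmLocalIntegralLevel` twice).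
[cite: Rogawski1990, §4.3 p. 44] -/
theorem eventually_pair_mem_prod_cmLocalIntegralLevel (g₂ : (cmDatum L N₂ H₂).Adelic) (g₁ : (cmDatum L N₁ H₁).Adelic) :
    ∀ᶠ v : HeightOneSpectrum (𝓞 ↥(maximalRealSubfield L)) in Filter.cofinite,
      ((cmDatum L N₂ H₂).toLocal v g₂, (cmDatum L N₁ H₁).toLocal v g₁) ∈
        (cmLocalIntegralLevel L N₂ H₂ v).prod (cmLocalIntegralLevel L N₁ H₁ v) := by
  filter_upwards [eventually_toLocal_mem_cmLocalIntegralLevel g₂, eventually_toLocal_mem_cmLocalIntegralLevel g₁] with v h₂ h₁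
  exact ⟨h₂, h₁⟩

/-- `K_{H,v} = U(H₂)(𝒪_v) × U(H₁)(𝒪_v)` is compact open. [cite: Rogawski1990, §4.3 p. 44] -/
theorem isCompact_isOpen_prod_cmLocalIntegralLevel (v : HeightOneSpectrum (𝓞 ↥(maximalRealSubfield L))) :
    IsCompact (((cmLocalIntegralLevel L N₂ H₂ v).prod (cmLocalIntegralLevel L N₁ H₁ v) :
        Subgroup ((cmDatum L N₂ H₂).Local v × (cmDatum L N₁ H₁).Local v)) : Set ((cmDatum L N₂ H₂).Local v × (cmDatum L N₁ H₁).Local v)) ∧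
      IsOpen (((cmLocalIntegralLevel L N₂ H₂ v).prod (cmLocalIntegralLevel L N₁ H₁ v) :
        Subgroup ((cmDatum L N₂ H₂).Local v × (cmDatum L N₁ H₁).Local v)) : Set ((cmDatum L N₂ H₂).Local v × (cmDatum L N₁ H₁).Local v)) := by
  obtain ⟨h₂c, h₂o⟩ := isCompact_isOpen_cmLocalIntegralLevel L N₂ H₂ v
  obtain ⟨h₁c, h₁o⟩ := isCompact_isOpen_cmLocalIntegralLevel L N₁ H₁ v
  rw [Subgroup.coe_prod]
  exact ⟨h₂c.prod h₁c, h₂o.prod h₁o⟩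

/-- **Kottwitz's orbit lemma on the pair, at almost every place**: for `H₂`, `H₁` hermitian with `det ≠ 0` and rational regular `γ₂ ∈ U(H₂)(L⁺)`,
`γ₁ ∈ U(H₁)(L⁺)`, for all but finitely many `v` every `y ∈ U(H₂)(L⁺_v) × U(H₁)(L⁺_v)` with `y ((γ₂)_v, (γ₁)_v) y⁻¹ ∈ K_{H,v}` lies in
`K_{H,v} · Z(((γ₂)_v, (γ₁)_v))` (★ `unramifiedOrbitSetAE_of_hermitian` on each factor, §1 `orbitSet_prod`). [cite: Kottwitz1986, Prop. 7.1]
[cite: Rogawski1990, §4.3 p. 44] -/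
theorem eventually_forall_orbitSet_pair (hH₂ : (H₂.map (cmConjRingHom L))ᵀ = H₂) (hH₂d : H₂.det ≠ 0)
    (hH₁ : (H₁.map (cmConjRingHom L))ᵀ = H₁) (hH₁d : H₁.det ≠ 0)
    (γ₂ : (cmDatum L N₂ H₂).Rational) (hγ₂ : IsRegularElt (γ₂.val : GL (Fin N₂) L))
    (γ₁ : (cmDatum L N₁ H₁).Rational) (hγ₁ : IsRegularElt (γ₁.val : GL (Fin N₁) L)) :
    ∀ᶠ v : HeightOneSpectrum (𝓞 ↥(maximalRealSubfield L)) in Filter.cofinite,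
      ∀ y : (cmDatum L N₂ H₂).Local v × (cmDatum L N₁ H₁).Local v,
        y * ((cmDatum L N₂ H₂).toLocal v ((cmDatum L N₂ H₂).toAdelic γ₂), (cmDatum L N₁ H₁).toLocal v ((cmDatum L N₁ H₁).toAdelic γ₁)) * y⁻¹ ∈
            (cmLocalIntegralLevel L N₂ H₂ v).prod (cmLocalIntegralLevel L N₁ H₁ v) →
          y ∈ (((cmLocalIntegralLevel L N₂ H₂ v).prod (cmLocalIntegralLevel L N₁ H₁ v) :
              Subgroup ((cmDatum L N₂ H₂).Local v × (cmDatum L N₁ H₁).Local v)) : Set ((cmDatum L N₂ H₂).Local v × (cmDatum L N₁ H₁).Local v)) *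
            (Subgroup.centralizer ({((cmDatum L N₂ H₂).toLocal v ((cmDatum L N₂ H₂).toAdelic γ₂),
                (cmDatum L N₁ H₁).toLocal v ((cmDatum L N₁ H₁).toAdelic γ₁))} : Set ((cmDatum L N₂ H₂).Local v × (cmDatum L N₁ H₁).Local v)) :
              Set ((cmDatum L N₂ H₂).Local v × (cmDatum L N₁ H₁).Local v)) := by
  filter_upwards [unramifiedOrbitSetAE_of_hermitian L N₂ H₂ hH₂ hH₂d γ₂ hγ₂, unramifiedOrbitSetAE_of_hermitian L N₁ H₁ hH₁ hH₁d γ₁ hγ₁]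
    with v h₂ h₁
  exact orbitSet_prod _ _ _ _ h₂ h₁

/-- **`compactCore Z(((γ₂)_v, (γ₁)_v)) ⊆ K_{H,v}` for almost every `v`** (★ `compactCoreCentralizerLevelAE_of_hermitian` on each factor, §1
`compactCore_centralizer_prodMk_subset`). [cite: Rogawski1990, §4.3 (p. 43)] [cite: BourbakiGT1, Ch. III §2] -/
theorem eventually_compactCore_centralizer_pair_subset (hH₂ : (H₂.map (cmConjRingHom L))ᵀ = H₂) (hH₂d : H₂.det ≠ 0)
    (hH₁ : (H₁.map (cmConjRingHom L))ᵀ = H₁) (hH₁d : H₁.det ≠ 0)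
    (γ₂ : (cmDatum L N₂ H₂).Rational) (hγ₂ : IsRegularElt (γ₂.val : GL (Fin N₂) L))
    (γ₁ : (cmDatum L N₁ H₁).Rational) (hγ₁ : IsRegularElt (γ₁.val : GL (Fin N₁) L)) :
    ∀ᶠ v : HeightOneSpectrum (𝓞 ↥(maximalRealSubfield L)) in Filter.cofinite,
      compactCore (Subgroup.centralizer ({((cmDatum L N₂ H₂).toLocal v ((cmDatum L N₂ H₂).toAdelic γ₂),
          (cmDatum L N₁ H₁).toLocal v ((cmDatum L N₁ H₁).toAdelic γ₁))} : Set ((cmDatum L N₂ H₂).Local v × (cmDatum L N₁ H₁).Local v))) ⊆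
        Subtype.val ⁻¹' ((cmLocalIntegralLevel L N₂ H₂ v : Set ((cmDatum L N₂ H₂).Local v)) ×ˢ
          (cmLocalIntegralLevel L N₁ H₁ v : Set ((cmDatum L N₁ H₁).Local v))) := by
  filter_upwards [compactCoreCentralizerLevelAE_of_hermitian L N₂ H₂ hH₂ hH₂d γ₂ hγ₂,
    compactCoreCentralizerLevelAE_of_hermitian L N₁ H₁ hH₁ hH₁d γ₁ hγ₁] with v h₂ h₁
  exact compactCore_centralizer_prodMk_subset _ _ h₂ h₁

/-! ## §3 The unit factors `Φ_v([(γ_H)_v], 1_{K_{H,v}}) = 1` on the pair -/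

variable
  [∀ (v : HeightOneSpectrum (𝓞 ↥(maximalRealSubfield L))) (x : (cmDatum L N₂ H₂).Local v × (cmDatum L N₁ H₁).Local v),
    MeasurableSpace (((cmDatum L N₂ H₂).Local v × (cmDatum L N₁ H₁).Local v) ⧸
      Subgroup.centralizer ({x} : Set ((cmDatum L N₂ H₂).Local v × (cmDatum L N₁ H₁).Local v)))]
  [∀ (v : HeightOneSpectrum (𝓞 ↥(maximalRealSubfield L))) (x : (cmDatum L N₂ H₂).Local v × (cmDatum L N₁ H₁).Local v),
    BorelSpace (((cmDatum L N₂ H₂).Local v × (cmDatum L N₁ H₁).Local v) ⧸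
      Subgroup.centralizer ({x} : Set ((cmDatum L N₂ H₂).Local v × (cmDatum L N₁ H₁).Local v)))]
  (mH : ∀ v : HeightOneSpectrum (𝓞 ↥(maximalRealSubfield L)), OrbitalMeasureFamily ((cmDatum L N₂ H₂).Local v × (cmDatum L N₁ H₁).Local v))

/-- **`Φ_v([(γ_H)_v], 1_{K_{H,v}})` is the mass of the `K_{H,v}`-orbit, for almost every `v`** — local CLASS-indexed families `mH v` on the product
invariant at the class of `(γ_H)_v = ((γ₂)_v, (γ₁)_v)` (§2 + ★ `orbitalIntegral_indicator_eq_of_orbitSet` + ★ `OrbitalMeasureFamily.orbitalIntegral_atPoint`).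
[cite: Kottwitz1986, Prop. 7.1] [cite: Rogawski1990, §4.3 p. 44] -/
theorem eventually_classOrbitalIntegral_indicator_eq_atPoint_pair (hH₂ : (H₂.map (cmConjRingHom L))ᵀ = H₂) (hH₂d : H₂.det ≠ 0)
    (hH₁ : (H₁.map (cmConjRingHom L))ᵀ = H₁) (hH₁d : H₁.det ≠ 0)
    (γ₂ : (cmDatum L N₂ H₂).Rational) (hγ₂ : IsRegularElt (γ₂.val : GL (Fin N₂) L))
    (γ₁ : (cmDatum L N₁ H₁).Rational) (hγ₁ : IsRegularElt (γ₁.val : GL (Fin N₁) L))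
    (hinv : ∀ v, SMulInvariantMeasure ((cmDatum L N₂ H₂).Local v × (cmDatum L N₁ H₁).Local v) _
      (mH v (ConjClasses.mk ((cmDatum L N₂ H₂).toLocal v ((cmDatum L N₂ H₂).toAdelic γ₂), (cmDatum L N₁ H₁).toLocal v ((cmDatum L N₁ H₁).toAdelic γ₁))))) :
    ∀ᶠ v : HeightOneSpectrum (𝓞 ↥(maximalRealSubfield L)) in Filter.cofinite,
      classOrbitalIntegral (mH v)
          (((cmLocalIntegralLevel L N₂ H₂ v : Set ((cmDatum L N₂ H₂).Local v)) ×ˢ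
              (cmLocalIntegralLevel L N₁ H₁ v : Set ((cmDatum L N₁ H₁).Local v))).indicator fun _ => (1 : ℂ))
          (ConjClasses.mk ((cmDatum L N₂ H₂).toLocal v ((cmDatum L N₂ H₂).toAdelic γ₂), (cmDatum L N₁ H₁).toLocal v ((cmDatum L N₁ H₁).toAdelic γ₁))) =
        (((mH v).atPoint ((cmDatum L N₂ H₂).toLocal v ((cmDatum L N₂ H₂).toAdelic γ₂), (cmDatum L N₁ H₁).toLocal v ((cmDatum L N₁ H₁).toAdelic γ₁))
          ((QuotientGroup.mk : (cmDatum L N₂ H₂).Local v × (cmDatum L N₁ H₁).Local v → _) ''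
            ((cmLocalIntegralLevel L N₂ H₂ v : Set ((cmDatum L N₂ H₂).Local v)) ×ˢ
              (cmLocalIntegralLevel L N₁ H₁ v : Set ((cmDatum L N₁ H₁).Local v))))).toReal : ℂ) := by
  filter_upwards [eventually_forall_orbitSet_pair L H₂ H₁ hH₂ hH₂d hH₁ hH₁d γ₂ hγ₂ γ₁ hγ₁,
    eventually_pair_mem_prod_cmLocalIntegralLevel L H₂ H₁ ((cmDatum L N₂ H₂).toAdelic γ₂) ((cmDatum L N₁ H₁).toAdelic γ₁)] with v hv hγv
  haveI := hinv v
  rw [← (mH v).orbitalIntegral_atPoint]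
  exact orbitalIntegral_indicator_eq_of_orbitSet _ _ ((cmLocalIntegralLevel L N₂ H₂ v).prod (cmLocalIntegralLevel L N₁ H₁ v))
    (isCompact_isOpen_prod_cmLocalIntegralLevel L H₂ H₁ v).2 hγv hv

/-- **`Φ_v([(γ_H)_v], 1_{K_{H,v}}) = 1` for almost every `v`, on the pair**: local families invariant at the class and NORMALISED at
`((γ₂)_v, (γ₁)_v)` off `S₀` — `(mH v).atPoint (γ_H)_v (π K_{H,v}) = 1` for `v ∉ S₀`, the literal of ★ `IsNormalisedOff` on the product.
[cite: Kottwitz1986, Cor. 7.3] [cite: Rogawski1990, §4.3 p. 44] -/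
theorem eventually_classOrbitalIntegral_indicator_eq_one_pair (hH₂ : (H₂.map (cmConjRingHom L))ᵀ = H₂) (hH₂d : H₂.det ≠ 0)
    (hH₁ : (H₁.map (cmConjRingHom L))ᵀ = H₁) (hH₁d : H₁.det ≠ 0)
    (γ₂ : (cmDatum L N₂ H₂).Rational) (hγ₂ : IsRegularElt (γ₂.val : GL (Fin N₂) L))
    (γ₁ : (cmDatum L N₁ H₁).Rational) (hγ₁ : IsRegularElt (γ₁.val : GL (Fin N₁) L))
    (hinv : ∀ v, SMulInvariantMeasure ((cmDatum L N₂ H₂).Local v × (cmDatum L N₁ H₁).Local v) _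
      (mH v (ConjClasses.mk ((cmDatum L N₂ H₂).toLocal v ((cmDatum L N₂ H₂).toAdelic γ₂), (cmDatum L N₁ H₁).toLocal v ((cmDatum L N₁ H₁).toAdelic γ₁)))))
    {S₀ : Finset (HeightOneSpectrum (𝓞 ↥(maximalRealSubfield L)))}
    (hS₀ : ∀ v, v ∉ S₀ →
      (mH v).atPoint ((cmDatum L N₂ H₂).toLocal v ((cmDatum L N₂ H₂).toAdelic γ₂), (cmDatum L N₁ H₁).toLocal v ((cmDatum L N₁ H₁).toAdelic γ₁))
        ((QuotientGroup.mk : (cmDatum L N₂ H₂).Local v × (cmDatum L N₁ H₁).Local v → _) ''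
          ((cmLocalIntegralLevel L N₂ H₂ v : Set ((cmDatum L N₂ H₂).Local v)) ×ˢ
            (cmLocalIntegralLevel L N₁ H₁ v : Set ((cmDatum L N₁ H₁).Local v)))) = 1) :
    ∀ᶠ v : HeightOneSpectrum (𝓞 ↥(maximalRealSubfield L)) in Filter.cofinite,
      classOrbitalIntegral (mH v)
          (((cmLocalIntegralLevel L N₂ H₂ v : Set ((cmDatum L N₂ H₂).Local v)) ×ˢ
              (cmLocalIntegralLevel L N₁ H₁ v : Set ((cmDatum L N₁ H₁).Local v))).indicator fun _ => (1 : ℂ))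
          (ConjClasses.mk ((cmDatum L N₂ H₂).toLocal v ((cmDatum L N₂ H₂).toAdelic γ₂), (cmDatum L N₁ H₁).toLocal v ((cmDatum L N₁ H₁).toAdelic γ₁))) =
        1 := by
  filter_upwards [eventually_classOrbitalIntegral_indicator_eq_atPoint_pair L H₂ H₁ mH hH₂ hH₂d hH₁ hH₁d γ₂ hγ₂ γ₁ hγ₁ hinv,
    S₀.eventually_cofinite_notMem] with v hv hvS
  rw [hv, hS₀ v hvS, ENNReal.toReal_one, Complex.ofReal_one]

/-- **The `h1` shape on the pair**: for an UNRAMIFIED ★ `PureTensor₂` `T` (`T.loc v = 1_{K_{H,v}}` off `T.S`), a finite `S₂ ⊇ T.S` with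
`Φ_v([(γ_H)_v], T.loc v) = 1` for every `v ∉ S₂`. [cite: Rogawski1990, §4.3 p. 44; §4.9 p. 54] -/
theorem exists_finset_forall_classOrbitalIntegral_loc_eq_one_pair (hH₂ : (H₂.map (cmConjRingHom L))ᵀ = H₂) (hH₂d : H₂.det ≠ 0)
    (hH₁ : (H₁.map (cmConjRingHom L))ᵀ = H₁) (hH₁d : H₁.det ≠ 0)
    (γ₂ : (cmDatum L N₂ H₂).Rational) (hγ₂ : IsRegularElt (γ₂.val : GL (Fin N₂) L))
    (γ₁ : (cmDatum L N₁ H₁).Rational) (hγ₁ : IsRegularElt (γ₁.val : GL (Fin N₁) L))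
    (hinv : ∀ v, SMulInvariantMeasure ((cmDatum L N₂ H₂).Local v × (cmDatum L N₁ H₁).Local v) _
      (mH v (ConjClasses.mk ((cmDatum L N₂ H₂).toLocal v ((cmDatum L N₂ H₂).toAdelic γ₂), (cmDatum L N₁ H₁).toLocal v ((cmDatum L N₁ H₁).toAdelic γ₁)))))
    {S₀ : Finset (HeightOneSpectrum (𝓞 ↥(maximalRealSubfield L)))}
    (hS₀ : ∀ v, v ∉ S₀ →
      (mH v).atPoint ((cmDatum L N₂ H₂).toLocal v ((cmDatum L N₂ H₂).toAdelic γ₂), (cmDatum L N₁ H₁).toLocal v ((cmDatum L N₁ H₁).toAdelic γ₁))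
        ((QuotientGroup.mk : (cmDatum L N₂ H₂).Local v × (cmDatum L N₁ H₁).Local v → _) ''
          ((cmLocalIntegralLevel L N₂ H₂ v : Set ((cmDatum L N₂ H₂).Local v)) ×ˢ
            (cmLocalIntegralLevel L N₁ H₁ v : Set ((cmDatum L N₁ H₁).Local v)))) = 1)
    (T : PureTensor₂ L H₂ H₁) (hT : T.IsUnramified₂) :
    ∃ S₂ : Finset (HeightOneSpectrum (𝓞 ↥(maximalRealSubfield L))), T.S ⊆ S₂ ∧
      ∀ v, v ∉ S₂ → classOrbitalIntegral (mH v) (T.loc v)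
        (ConjClasses.mk ((cmDatum L N₂ H₂).toLocal v ((cmDatum L N₂ H₂).toAdelic γ₂), (cmDatum L N₁ H₁).toLocal v ((cmDatum L N₁ H₁).toAdelic γ₁))) = 1 := by
  classical
  have h := eventually_classOrbitalIntegral_indicator_eq_one_pair L H₂ H₁ mH hH₂ hH₂d hH₁ hH₁d γ₂ hγ₂ γ₁ hγ₁ hinv hS₀
  rw [Filter.eventually_cofinite] at h
  refine ⟨T.S ∪ h.toFinset, Finset.subset_union_left, fun v hv => ?_⟩
  rw [Finset.mem_union, not_or, Set.Finite.mem_toFinset, Set.mem_setOf_eq, not_not] at hv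
  rw [T.loc_eq_indicator v hv.1, (hT v hv.1).1, (hT v hv.1).2]
  exact hv.2

/-! ## §4 Canonical families on the pair are normalised off a finite set -/

variable [∀ v : HeightOneSpectrum (𝓞 ↥(maximalRealSubfield L)), MeasurableSpace ((cmDatum L N₂ H₂).Local v × (cmDatum L N₁ H₁).Local v)]
  [∀ v : HeightOneSpectrum (𝓞 ↥(maximalRealSubfield L)), BorelSpace ((cmDatum L N₂ H₂).Local v × (cmDatum L N₁ H₁).Local v)]

/-- **Canonical families on the pair ARE normalised at `((γ₂)_v, (γ₁)_v)` off a finite set** (`H₂`, `H₁` hermitian non-degenerate): for `mH v`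
canonical for `(P v, νH v)` (★ `IsCanonical`) with Haar measures of mass one on `K_{H,v}`, rational regular `γ₂`, `γ₁` whose class representatives
satisfy `P v`, there is a finite `S₀` with `(mH v).atPoint (γ_H)_v (π K_{H,v}) = 1` for every `v ∉ S₀` (★ `IsCanonical.atPoint_image_mk_eq_one`, §2
`eventually_compactCore_centralizer_pair_subset`). [cite: Rogawski1990, §4.3 (p. 43)] [cite: Kottwitz1986, Cor. 7.3] -/
theorem exists_finset_forall_atPoint_pair_eq_one_of_isCanonical (hH₂ : (H₂.map (cmConjRingHom L))ᵀ = H₂) (hH₂d : H₂.det ≠ 0)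
    (hH₁ : (H₁.map (cmConjRingHom L))ᵀ = H₁) (hH₁d : H₁.det ≠ 0)
    (P : ∀ v : HeightOneSpectrum (𝓞 ↥(maximalRealSubfield L)), (cmDatum L N₂ H₂).Local v × (cmDatum L N₁ H₁).Local v → Prop)
    (νH : ∀ v : HeightOneSpectrum (𝓞 ↥(maximalRealSubfield L)), Measure ((cmDatum L N₂ H₂).Local v × (cmDatum L N₁ H₁).Local v))
    [∀ v, (νH v).IsHaarMeasure] [∀ v, (νH v).IsMulRightInvariant]
    (hν : ∀ v, νH v ((cmLocalIntegralLevel L N₂ H₂ v : Set ((cmDatum L N₂ H₂).Local v)) ×ˢ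
      (cmLocalIntegralLevel L N₁ H₁ v : Set ((cmDatum L N₁ H₁).Local v))) = 1)
    (hcan : ∀ v, (mH v).IsCanonical (P v) (νH v))
    (γ₂ : (cmDatum L N₂ H₂).Rational) (hγ₂ : IsRegularElt (γ₂.val : GL (Fin N₂) L))
    (γ₁ : (cmDatum L N₁ H₁).Rational) (hγ₁ : IsRegularElt (γ₁.val : GL (Fin N₁) L))
    (hP : ∀ v, P v (Quotient.out (ConjClasses.mk
      ((cmDatum L N₂ H₂).toLocal v ((cmDatum L N₂ H₂).toAdelic γ₂), (cmDatum L N₁ H₁).toLocal v ((cmDatum L N₁ H₁).toAdelic γ₁))))) :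
    ∃ S₀ : Finset (HeightOneSpectrum (𝓞 ↥(maximalRealSubfield L))), ∀ v, v ∉ S₀ →
      (mH v).atPoint ((cmDatum L N₂ H₂).toLocal v ((cmDatum L N₂ H₂).toAdelic γ₂), (cmDatum L N₁ H₁).toLocal v ((cmDatum L N₁ H₁).toAdelic γ₁))
        ((QuotientGroup.mk : (cmDatum L N₂ H₂).Local v × (cmDatum L N₁ H₁).Local v → _) ''
          ((cmLocalIntegralLevel L N₂ H₂ v : Set ((cmDatum L N₂ H₂).Local v)) ×ˢ
            (cmLocalIntegralLevel L N₁ H₁ v : Set ((cmDatum L N₁ H₁).Local v)))) = 1 := by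
  have hcof := eventually_compactCore_centralizer_pair_subset L H₂ H₁ hH₂ hH₂d hH₁ hH₁d γ₂ hγ₂ γ₁ hγ₁
  rw [Filter.eventually_cofinite] at hcof
  refine ⟨hcof.toFinset, fun v hv => ?_⟩
  have hv' : compactCore (Subgroup.centralizer ({((cmDatum L N₂ H₂).toLocal v ((cmDatum L N₂ H₂).toAdelic γ₂),
        (cmDatum L N₁ H₁).toLocal v ((cmDatum L N₁ H₁).toAdelic γ₁))} : Set ((cmDatum L N₂ H₂).Local v × (cmDatum L N₁ H₁).Local v))) ⊆
      Subtype.val ⁻¹' ((cmLocalIntegralLevel L N₂ H₂ v : Set ((cmDatum L N₂ H₂).Local v)) ×ˢ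
        (cmLocalIntegralLevel L N₁ H₁ v : Set ((cmDatum L N₁ H₁).Local v))) := by
    by_contra hnot
    exact hv (hcof.mem_toFinset.2 hnot)
  obtain ⟨hKc, hKo⟩ := isCompact_isOpen_prod_cmLocalIntegralLevel L H₂ H₁ v
  exact (hcan v).atPoint_image_mk_eq_one _ (hP v) ((cmLocalIntegralLevel L N₂ H₂ v).prod (cmLocalIntegralLevel L N₁ H₁ v)) hKo hKc
    (hν v) hv'

end Literature.NumberTheory.Automorphic.UnitaryGroup

end
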